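import Summits.CriticalPhenomena.CardyFormulaZ2.Theses.CardySelfRefinement
import Literature.Probability.Percolation.QuadCrossingContinuityEventsProofs
import Literature.Probability.Percolation.QuadCrossingSubseqLimits
import HarnessLib

/-!
# Translation invariance of subsequential quad-crossing limits: stub `stub_translationInput` of
# line `crosscut-dictionary` for crux `LagHandOff` (stmt-CriticalPhenomena-10268)

Every subsequential scaling limit `μ ∈ Λ = subseqQuadLimits univ` of the full-plane quad-crossing
laws `μ_δ = z2QuadLaw univ δ` of critical bond percolation on `δℤ²` (Schramm–Smirnov space
`ℋ = QuadConfig univ`) is invariant under every translation `S ↦ w + S` of the plane.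

Proof.  (A) The translation action `(u, S) ↦ u + S` is JOINTLY continuous on `ℂ × ℋ`
(`continuous_translate_uncurry`), checked on the Schramm–Smirnov subbase: for `V_U` (`U` open in
the uniform metric of quads) by the estimate `d(u + Q₁, u₀ + Q) ≤ d(Q₁, Q) + |u - u₀|`; for `V^Q`
through a strictly smaller quad `Q' < Q - u₀` off the closed set `S₀`
(`Quad.exists_strictlyDominated_dist_lt`, `Quad.strictlyDominated_iff`) and the lower-set property
of configurations.  (B) Hence, `ℋ` being compact (`QuadConfig.compactSpace`), for every bounded
continuous `f` the functions `f (u + ·) - f` are uniformly small as `u → 0` (generalized tube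
lemma), so small translations of weakly convergent probability laws have the same weak limit
(`tendsto_map_translate_of_tendsto`).  (C) `μ_δ` is exactly invariant under the lattice
translations `δ v`, `v ∈ ℤ²` (`z2QuadLaw_map_translate_meshPoint`, Grimmett 1999 §1.6), and
`w` is within `δ` of `δℤ²` (`dist_meshPoint_nearestSite_le`); so along `δₖ → 0⁺`,
`μ_{δₖ} ∘ T_w⁻¹ = μ_{δₖ} ∘ T_{uₖ}⁻¹` with `uₖ → 0` converges both to `μ ∘ T_w⁻¹` and to `μ`, and the
weak topology on finite Borel measures of the metrizable `ℋ` is Hausdorff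
(`QuadConfig.hasOuterApproxClosed`).  References: O. Schramm, S. Smirnov, Ann. Probab. 39 (2011),
§1.3–1.4; G. Grimmett, *Percolation* (1999), §1.6.
-/

noncomputable section

open MeasureTheory Filter Set Topology
open scoped BoundedContinuousFunction
open Literature.Probability.Percolation Literature.Probability.LatticeModels
open Literature.Probability.RandomPlanarGeometry Literature.Probability.Percolation.QuadCrossing
open Summit.CriticalPhenomena.CardyFormulaZ2.Theses.CardySelfRefinement

namespace Summit.CriticalPhenomena.CardyFormulaZ2.Cruxes.LagHandOff.CrosscutDictionary

/-! ### (A) Joint continuity of the translation action -/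

/-- The uniform distance between translated quads is at most the distance of the quads plus the
distance of the translation vectors: `d(u + Q₁, u₀ + Q) ≤ d(Q₁, Q) + |u - u₀|`. -/
theorem dist_mapHomeomorph_addLeft_le (Q₁ Q : Quad (univ : Set ℂ)) (u u₀ : ℂ) :
    dist (Q₁.mapHomeomorph (Homeomorph.addLeft u)) (Q.mapHomeomorph (Homeomorph.addLeft u₀)) ≤
      dist Q₁ Q + dist u u₀ := by
  rw [Quad.dist_eq, ContinuousMap.dist_le (by positivity)]
  intro z
  simp only [Quad.toContinuousMap_apply, Quad.mapHomeomorph_apply, Homeomorph.coe_addLeft]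
  calc dist (u + Q₁ z) (u₀ + Q z) ≤ dist u u₀ + dist (Q₁ z) (Q z) := dist_add_add_le _ _ _ _
    _ ≤ dist u u₀ + dist Q₁ Q := by gcongr; exact Quad.dist_apply_le Q₁ Q z
    _ = dist Q₁ Q + dist u u₀ := add_comm _ _

/-- Translation of quads `(u, Q) ↦ u + Q` is jointly continuous on `ℂ × 𝒬_ℂ`. -/
theorem continuous_quad_translate :
    Continuous fun p : ℂ × Quad (univ : Set ℂ) => p.2.mapHomeomorph (Homeomorph.addLeft p.1) := by
  refine Metric.continuous_iff.mpr fun q ε hε => ⟨ε / 2, half_pos hε, fun p hp => ?_⟩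
  calc dist (p.2.mapHomeomorph (Homeomorph.addLeft p.1))
        (q.2.mapHomeomorph (Homeomorph.addLeft q.1))
      ≤ dist p.2 q.2 + dist p.1 q.1 := dist_mapHomeomorph_addLeft_le _ _ _ _
    _ < ε / 2 + ε / 2 := add_lt_add ((le_max_right _ _).trans_lt hp) ((le_max_left _ _).trans_lt hp)
    _ = ε := add_halves ε

/-- **Joint continuity of the translation action on `ℋ_ℂ`**: `(u, S) ↦ u + S` is continuous on
`ℂ × ℋ_ℂ`.  Checked on the Schramm–Smirnov subbase: the preimage of `V_U` is open by the metric
estimate `dist_mapHomeomorph_addLeft_le`; the preimage of `V^Q` at `(u₀, S₀)` contains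
`{u : Q - u ∈ U₂} × V^{Q'}` for a strictly smaller quad `Q' < Q - u₀` off `S₀` with witnessing
neighbourhoods `U₁ ∋ Q'`, `U₂ ∋ Q - u₀` (a configuration containing `Q - u ∈ U₂` contains `Q'`,
being a lower set). -/
theorem continuous_translate_uncurry :
    Continuous fun p : ℂ × QuadConfig (univ : Set ℂ) => QuadConfig.translate p.1 p.2 := by
  refine continuous_generateFrom_iff.mpr ?_
  rintro V (⟨U, hU, rfl⟩ | ⟨Q, rfl⟩)
  · -- the subbasic set `V_U`
    refine isOpen_prod_iff.mpr fun u₀ S₀ hmem => ?_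
    obtain ⟨P, hPS, hPU⟩ := hmem
    obtain ⟨Q, hQ, rfl⟩ :
        P ∈ Quad.congrHomeomorph (Homeomorph.addLeft u₀) '' (S₀ : Set (Quad (univ : Set ℂ))) := hPS
    obtain ⟨ε, hε, hball⟩ := Metric.isOpen_iff.mp hU _ hPU
    refine ⟨Metric.ball u₀ (ε / 2), QuadConfig.someCrossed (Metric.ball Q (ε / 2)),
      Metric.isOpen_ball, QuadConfig.isOpen_someCrossed Metric.isOpen_ball,
      Metric.mem_ball_self (half_pos hε), ⟨Q, hQ, Metric.mem_ball_self (half_pos hε)⟩, ?_⟩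
    rintro ⟨u, S⟩ ⟨hu, ⟨Q₁, hQ₁S, hQ₁⟩⟩
    refine ⟨Q₁.mapHomeomorph (Homeomorph.addLeft u), ⟨Q₁, hQ₁S, rfl⟩, hball ?_⟩
    rw [Metric.mem_ball] at hu hQ₁ ⊢
    calc dist (Q₁.mapHomeomorph (Homeomorph.addLeft u)) (Q.mapHomeomorph (Homeomorph.addLeft u₀))
        ≤ dist Q₁ Q + dist u u₀ := dist_mapHomeomorph_addLeft_le _ _ _ _
      _ < ε / 2 + ε / 2 := add_lt_add hQ₁ hu
      _ = ε := add_halves ε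
  · -- the subbasic set `V^Q`
    refine isOpen_prod_iff.mpr fun u₀ S₀ hmem => ?_
    have hQ₀ : Q.mapHomeomorph (Homeomorph.addLeft (-u₀)) ∉ S₀ := by
      rw [← Homeomorph.addLeft_symm]
      exact fun h => hmem ((QuadConfig.mem_mapHomeomorph _).mpr h)
    obtain ⟨ε, hε, hball⟩ := Metric.isOpen_iff.mp S₀.isClosed.isOpen_compl _ hQ₀
    obtain ⟨Q', hd, hlt⟩ := Quad.exists_strictlyDominated_dist_lt isOpen_univ
      (Q.mapHomeomorph (Homeomorph.addLeft (-u₀))) hε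
    have hQ'S₀ : Q' ∉ S₀ := hball (Metric.mem_ball.mpr hd)
    obtain ⟨U₁, U₂, hU₁, hU₂, h₁, h₂, hdom⟩ := Quad.strictlyDominated_iff.mp hlt
    have hlt' : ∀ P ∈ U₂, Quad.StrictlyDominated Q' P := fun P hP =>
      Quad.strictlyDominated_iff.mpr ⟨U₁, U₂, hU₁, hU₂, h₁, hP, hdom⟩
    refine ⟨(fun u : ℂ => Q.mapHomeomorph (Homeomorph.addLeft (-u))) ⁻¹' U₂,
      QuadConfig.notCrossed Q', hU₂.preimage ?_, QuadConfig.isOpen_notCrossed Q', h₂, hQ'S₀, ?_⟩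
    · exact continuous_quad_translate.comp (continuous_neg.prodMk continuous_const)
    · rintro ⟨u, S⟩ ⟨hu, hS⟩ hmemQ
      have hQS : Q.mapHomeomorph (Homeomorph.addLeft (-u)) ∈ S := by
        rw [← Homeomorph.addLeft_symm]
        exact (QuadConfig.mem_mapHomeomorph _).mp hmemQ
      exact hS (S.isLowerQuadSet hQS (hlt' _ hu))

/-! ### (B) Small translations of weakly convergent laws -/

/-- `0 + S = S`. -/
theorem translate_zero (S : QuadConfig (univ : Set ℂ)) : QuadConfig.translate 0 S = S := by
  have h : Homeomorph.addLeft (0 : ℂ) = Homeomorph.refl ℂ := by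
    ext z
    simp
  rw [QuadConfig.translate, h, QuadConfig.mapHomeomorph_refl]

/-- `(u + m) + S = u + (m + S)`: the translation action is an action. -/
theorem translate_add (u m : ℂ) (S : QuadConfig (univ : Set ℂ)) :
    QuadConfig.translate (u + m) S = QuadConfig.translate u (QuadConfig.translate m S) := by
  have h : Homeomorph.addLeft (u + m) = (Homeomorph.addLeft m).trans (Homeomorph.addLeft u) := by
    ext z
    simp [add_assoc]
  rw [QuadConfig.translate, h, QuadConfig.mapHomeomorph_trans]
  rfl

/-- **Uniform smallness of small translations**: for a bounded continuous `f` on `ℋ_ℂ` and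
`ε > 0` there is `η > 0` with `|f (u + S) - f S| < ε` for all `S` once `|u| < η` (joint continuity
of the action, compactness of `ℋ_ℂ`, generalized tube lemma). -/
theorem exists_forall_dist_translate_lt (f : QuadConfig (univ : Set ℂ) →ᵇ ℝ) {ε : ℝ}
    (hε : 0 < ε) :
    ∃ η > 0, ∀ u : ℂ, ‖u‖ < η → ∀ S, dist (f (QuadConfig.translate u S)) (f S) < ε := by
  haveI : CompactSpace (QuadConfig (univ : Set ℂ)) := QuadConfig.compactSpace
  set W : Set (ℂ × QuadConfig (univ : Set ℂ)) :=
    {p | dist (f (QuadConfig.translate p.1 p.2)) (f p.2) < ε} with hW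
  have hWo : IsOpen W :=
    isOpen_lt ((f.continuous.comp continuous_translate_uncurry).dist
      (f.continuous.comp continuous_snd)) continuous_const
  have hsub : ({0} : Set ℂ) ×ˢ (univ : Set (QuadConfig (univ : Set ℂ))) ⊆ W := by
    rintro ⟨u, S⟩ ⟨hu, -⟩
    obtain rfl : u = 0 := hu
    show dist (f (QuadConfig.translate 0 S)) (f S) < ε
    rw [translate_zero, dist_self]
    exact hε
  obtain ⟨U, V, hU, -, h0U, hV, hUV⟩ :=
    generalized_tube_lemma isCompact_singleton isCompact_univ hWo hsub
  obtain ⟨η, hη, hball⟩ := Metric.isOpen_iff.mp hU 0 (h0U (mem_singleton 0))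
  refine ⟨η, hη, fun u hu S => ?_⟩
  have hmem : (u, S) ∈ W := hUV ⟨hball (mem_ball_zero_iff.mpr hu), hV (mem_univ S)⟩
  exact hmem

/-- **Small translations do not change weak limits**: if probability laws `μs n` on `ℋ_ℂ`
converge weakly to `μ` and `u n → 0`, then the translated laws `μs n ∘ T_{u n}⁻¹` also converge
weakly to `μ` (for bounded continuous `f`,
`|∫ f ∘ T_{u n} dμs n - ∫ f dμs n| ≤ sup |f ∘ T_{u n} - f| → 0` by
`exists_forall_dist_translate_lt`). -/
theorem tendsto_map_translate_of_tendsto {μs : ℕ → FiniteMeasure (QuadConfig (univ : Set ℂ))}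
    {μ : FiniteMeasure (QuadConfig (univ : Set ℂ))} (hlim : Tendsto μs atTop (𝓝 μ))
    (hprob : ∀ n, IsProbabilityMeasure (μs n : Measure (QuadConfig (univ : Set ℂ))))
    {u : ℕ → ℂ} (hu : Tendsto u atTop (𝓝 0)) :
    Tendsto (fun n => (μs n).map (QuadConfig.translate (u n))) atTop (𝓝 μ) := by
  refine FiniteMeasure.tendsto_iff_forall_integral_tendsto.mpr fun f => ?_
  have hf := (FiniteMeasure.tendsto_iff_forall_integral_tendsto.mp hlim) f
  have hint : ∀ n, ∫ x, f x ∂((μs n).map (QuadConfig.translate (u n)) :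
      Measure (QuadConfig (univ : Set ℂ))) =
        ∫ x, f (QuadConfig.translate (u n) x) ∂(μs n : Measure (QuadConfig (univ : Set ℂ))) :=
    fun n => by
      rw [FiniteMeasure.toMeasure_map, integral_map (QuadConfig.measurable_translate _).aemeasurable
        f.continuous.aestronglyMeasurable]
  simp_rw [hint]
  have hdiff : Tendsto (fun n => ∫ x, f (QuadConfig.translate (u n) x) ∂(μs n : Measure _) -
      ∫ x, f x ∂(μs n : Measure _)) atTop (𝓝 0) := by
    refine NormedAddGroup.tendsto_nhds_zero.mpr fun ε hε => ?_
    obtain ⟨η, hη, hunif⟩ := exists_forall_dist_translate_lt f (half_pos hε)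
    filter_upwards [NormedAddGroup.tendsto_nhds_zero.mp hu η hη] with n hn
    haveI := hprob n
    have hi : Integrable (fun x => f (QuadConfig.translate (u n) x)) (μs n : Measure _) :=
      (f.integrable _).comp_measurable (QuadConfig.measurable_translate _)
    rw [← integral_sub hi (f.integrable _)]
    have hbound : ∀ x, ‖f (QuadConfig.translate (u n) x) - f x‖ ≤ ε / 2 := fun x => by
      rw [Real.norm_eq_abs, ← Real.dist_eq]
      exact (hunif (u n) hn x).le
    calc ‖∫ x, f (QuadConfig.translate (u n) x) - f x ∂(μs n : Measure (QuadConfig (univ : Set ℂ)))‖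
        ≤ ε / 2 * (μs n : Measure (QuadConfig (univ : Set ℂ))).real univ :=
          norm_integral_le_of_norm_le_const (ae_of_all _ hbound)
      _ = ε / 2 := by rw [probReal_univ, mul_one]
      _ < ε := half_lt_self hε
  have := hdiff.add hf
  simpa only [sub_add_cancel, zero_add] using this

/-! ### (C) Exact lattice invariance and the limit -/

/-- **Exact lattice invariance, recentred**: translating `μ_δ` by `w` is translating it by
`w - δ v` for any lattice vector `δ v`, `v ∈ ℤ²` (`z2QuadLaw_map_translate_meshPoint`). -/
theorem z2QuadLaw_map_translate_eq (δ : ℝ) (v : Site 2) (w : ℂ) :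
    (z2QuadLaw univ δ).map (QuadConfig.translate w) =
      (z2QuadLaw univ δ).map (QuadConfig.translate (w - meshPoint δ v)) := by
  have hfun : QuadConfig.translate w =
      QuadConfig.translate (w - meshPoint δ v) ∘ QuadConfig.translate (meshPoint δ v) := by
    funext S
    rw [Function.comp_apply, ← translate_add, sub_add_cancel]
  apply FiniteMeasure.toMeasure_injective
  rw [FiniteMeasure.toMeasure_map, FiniteMeasure.toMeasure_map, hfun,
    ← Measure.map_map (QuadConfig.measurable_translate _) (QuadConfig.measurable_translate _),
    ← FiniteMeasure.toMeasure_map, z2QuadLaw_map_translate_meshPoint]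

/-- **Translation invariance of subsequential scaling limits** (`TranslationInput` of line
`crosscut-dictionary`): every `μ ∈ Λ = subseqQuadLimits univ` satisfies `μ ∘ T_w⁻¹ = μ` for every
`w ∈ ℂ`.  Along `δₖ → 0⁺` with `μ_{δₖ} → μ`: `μ_{δₖ} ∘ T_w⁻¹ → μ ∘ T_w⁻¹` (continuity of `T_w`),
`μ_{δₖ} ∘ T_w⁻¹ = μ_{δₖ} ∘ T_{uₖ}⁻¹` with `uₖ = w - δₖ vₖ → 0` (exact lattice invariance), and
`μ_{δₖ} ∘ T_{uₖ}⁻¹ → μ` (`tendsto_map_translate_of_tendsto`); limits are unique. -/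
theorem stub_translationInput :
    ∀ μ ∈ subseqQuadLimits (Set.univ : Set ℂ), ∀ w : ℂ, μ.map (QuadConfig.translate w) = μ := by
  intro μ hμ w
  obtain ⟨δs, hpos, hδ0, hlim⟩ := (isSubseqQuadLimit_iff univ μ).mp hμ
  haveI : HasOuterApproxClosed (QuadConfig (univ : Set ℂ)) :=
    QuadConfig.hasOuterApproxClosed isOpen_univ univ_nonempty
  -- lattice approximations `δₖ vₖ` of `w`, errors `uₖ → 0`
  have hu0 : Tendsto (fun n => w - meshPoint (δs n) (nearestSite (δs n) w)) atTop (𝓝 0) := by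
    refine squeeze_zero_norm (fun n => ?_) hδ0
    rw [← dist_eq_norm, dist_comm]
    exact dist_meshPoint_nearestSite_le (hpos n) w
  have h1 : Tendsto (fun n => (z2QuadLaw univ (δs n)).map (QuadConfig.translate w)) atTop
      (𝓝 (μ.map (QuadConfig.translate w))) :=
    FiniteMeasure.tendsto_map_of_tendsto_of_continuous _ _ hlim
      (QuadConfig.continuous_mapHomeomorph _)
  have h2 := tendsto_map_translate_of_tendsto hlim
    (fun n => isProbabilityMeasure_z2QuadLaw_of_pos isOpen_univ (hpos n)) hu0
  exact tendsto_nhds_unique (h1.congr fun n => z2QuadLaw_map_translate_eq (δs n) _ w) h2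

end Summit.CriticalPhenomena.CardyFormulaZ2.Cruxes.LagHandOff.CrosscutDictionary

end
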